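import Summits.ValiantsHypothesis.ValiantsHypothesis.Theorems.GrenetZeonDualUnipotentThreeHalvesWordFlagDuality

/-!
# `GrenetZeon.DualUnipotentThreeHalves` (stmt-ValiantsHypothesis-24318) — line «radical_split» §7, pencil level:
# `FlagCheap` IN WORD CURRENCY, the refuter's enemy criterion, and S3b / R2 ⟺ their word forms

Port (val-lit merged desk, b71 (B) port pool; porter val-port-1 g2; text = val-idea-9 g4's §7, VERBATIM, credited) of the
pencil-level half of `Cruxes/DualUnipotentThreeHalves/Lines/radical_split.lean` @749d8538785a §7, over
`…GrenetZeonDualUnipotentThreeHalvesWordFlagDuality` (the pair-level duality `flagAdaptedUpTo_iff_wordTame`).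

* `coeffs_map_lineSubst` — the one-variable pencil along `x + s·v` has constant part `N(x)`, `s`-part `N_lin(v)`, no `s²`
  (port-3's `…RadicalCoarsening.coeff_map_lineSubst` in this vocabulary).
* ★ `flagCheap_iff_wordTame` — for affine `N`: `FlagCheap n m N ↔ ∃ K k, (k+1)·n < dim K ∧ ∀ x, ∀ v ∈ K,
  WordTame n k (N(x)) (N_lin(v))` — the exact atomic content of S3b / R2: no flags, no bases, nonzero-word profiles.
* `not_flagCheap_of_words` — ENEMY CRITERION: a nonzero word of length `≤ n − 1` with `> k` letters `N_lin(v)` on some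
  line of EVERY large `K` kills flag-cheapness.
* `flagCheap_iff_wordCheap`, `flagCostLaw_iff_word` (S3b ⟺ `FlagCostWordLaw`), `heavyTopLaw_iff_word`
  (R2 ⟺ `HeavyTopWordLaw`).
* Word toolkit (§8's generic lemmas): `word_cons`, `word_zero_right_eq_zero`, `wordTame_zero_right` (a zero top is tame
  with budget `0`), `count_true_le_of_sq_eq_zero` / `wordTame_of_sq_eq_zero` (a square-zero top is tame with budget `⌊n/2⌋`),
  `word_replicate_true`, `pow_eq_zero_of_wordTame` (budget `k`, `k + 2 ≤ n` ⇒ `Q^{k+1} = 0`).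

Honest framing.  Helper lemmas (`--supports stmt-ValiantsHypothesis-24318 --as helper`); the laws `FlagCostLaw`,
`HeavyTopLaw` and their word twins are `Prop`s related by `iff`, never asserted; S3b, R2, the crux
`DualUnipotentThreeHalves`, rung 8062 and `VP ≠ VNP` are untouched / NOT proved.  [this line's workfile; p613488]
-/

-- `Summit.ValiantsHypothesis.ValiantsHypothesis.…` repeats a component by the D-0017 layout
-- (single-conjunct summit), which the `dupNamespace` linter flags; the name is mandated.
set_option linter.dupNamespace false

noncomputable section

namespace Summit.ValiantsHypothesis.ValiantsHypothesis.Theorems.GrenetZeon.RadicalSplit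

open MvPolynomial Matrix
open scoped BigOperators
open Summit.ValiantsHypothesis.ValiantsHypothesis.Cruxes.TwoDimCoefficients.DimTwoCases (AffMat IsAffine)
open Summit.ValiantsHypothesis.ValiantsHypothesis.Theorems.GrenetZeon.RadicalCoarsening (coeff_map_lineSubst)

variable {m : ℕ}

/-- The one-variable pencil along `x + s·v`: constant part `N(x)`, `s`-part `N_lin(v)`, no `s²` (FineFlag
`coeff_map_lineSubst`, in this file's vocabulary). [folklore] -/
theorem coeffs_map_lineSubst {n : ℕ} (N : AffMat n m) (hN : IsAffine N) (x v : Fin n × Fin n → ℂ) :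
    (N.map (lineSubst x v)).map (coeff 0) = N.map (MvPolynomial.eval x) ∧
    (N.map (lineSubst x v)).map (coeff (Finsupp.single 0 1)) = linPart N v ∧
    (∀ d : Fin 1 →₀ ℕ, 2 ≤ d 0 → ∀ i j, coeff d ((N.map (lineSubst x v)) i j) = 0) :=
  coeff_map_lineSubst N hN x v

/-- **`FlagCheap` in word currency** (affine pencils): `N` is flag-cheap iff some direction space `K` with
`(k+1)·n < dim K` carries, on every line `x + s·v` (`v ∈ K`), only WORD-TAME pairs `(N(x), N_lin(v))` of budget `k`.
This is the exact atomic content of S3b / R2: no flags, no bases — nonzero-word profiles. [this file] -/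
theorem flagCheap_iff_wordTame {n : ℕ} (N : AffMat n m) (hN : IsAffine N) :
    FlagCheap n m N ↔ ∃ (K : Submodule ℂ (Fin n × Fin n → ℂ)) (k : ℕ), (k + 1) * n < Module.finrank ℂ K ∧
      ∀ x v : Fin n × Fin n → ℂ, v ∈ K → WordTame n k (N.map (MvPolynomial.eval x)) (linPart N v) := by
  unfold FlagCheap
  constructor
  · rintro ⟨K, k, hK, hdim⟩
    have hKn : Module.finrank ℂ K ≤ n * n := by
      have h1 := Submodule.finrank_le K
      rw [Module.finrank_fintype_fun_eq_card, Fintype.card_prod, Fintype.card_fin] at h1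
      exact h1
    have hkn : k + 2 ≤ n := by
      have h2 : (k + 1) * n < n * n := lt_of_lt_of_le hdim hKn
      have h3 : k + 1 < n := Nat.lt_of_mul_lt_mul_right h2
      omega
    refine ⟨K, k, hdim, fun x v hv => ?_⟩
    obtain ⟨h0, h1, -⟩ := coeffs_map_lineSubst N hN x v
    rw [← h0, ← h1]
    exact wordTame_of_flagAdaptedUpTo _ hkn (hK x v hv)
  · rintro ⟨K, k, hdim, hW⟩
    refine ⟨K, k, fun x v hv => ?_, hdim⟩
    obtain ⟨h0, h1, h2⟩ := coeffs_map_lineSubst N hN x v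
    refine flagAdaptedUpTo_of_wordTame _ h2 ?_
    rw [h0, h1]
    exact hW x v hv

/-- **ENEMY CRITERION (word form; what a refutation of S3b / R2 on a given pencil must exhibit).**  If inside EVERY
direction space `K` with `(k+1)·n < dim K` some line `x + s·v`, `v ∈ K`, carries a NONZERO word in `{N(x), N_lin(v)}`
of length `≤ n − 1` with more than `k` letters `N_lin(v)`, then `N` is not flag-cheap. [this file; p613488] -/
theorem not_flagCheap_of_words {n : ℕ} (N : AffMat n m) (hN : IsAffine N)
    (h : ∀ (K : Submodule ℂ (Fin n × Fin n → ℂ)) (k : ℕ), (k + 1) * n < Module.finrank ℂ K →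
      ∃ x v : Fin n × Fin n → ℂ, v ∈ K ∧ ∃ w : List Bool,
        word (N.map (MvPolynomial.eval x)) (linPart N v) w ≠ 0 ∧ k < w.count true ∧ w.length ≤ n - 1) :
    ¬ FlagCheap n m N := by
  rw [flagCheap_iff_wordTame N hN]
  rintro ⟨K, k, hdim, hW⟩
  obtain ⟨x, v, hv, w, hw, he, hl⟩ := h K k hdim
  exact not_wordTame_of_word _ _ w hw he hl (hW x v hv)

/-- `FlagCheap ↔ WordCheap` for affine pencils (`WordCheap` = the word-currency twin). -/
theorem flagCheap_iff_wordCheap {n : ℕ} (N : AffMat n m) (hN : IsAffine N) : FlagCheap n m N ↔ WordCheap n m N :=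
  flagCheap_iff_wordTame N hN

/-- S3b ⟺ its word form. [this file] -/
theorem flagCostLaw_iff_word : FlagCostLaw ↔ FlagCostWordLaw := by
  constructor
  · rintro ⟨C₀, n₀, h⟩
    exact ⟨C₀, n₀, fun n hn m' hm N hN hnil => (flagCheap_iff_wordCheap N hN).1 (h n hn m' hm N hN hnil)⟩
  · rintro ⟨C₀, n₀, h⟩
    exact ⟨C₀, n₀, fun n hn m' hm N hN hnil => (flagCheap_iff_wordCheap N hN).2 (h n hn m' hm N hN hnil)⟩

/-- R2 ⟺ its word form. [this file] -/
theorem heavyTopLaw_iff_word : HeavyTopLaw ↔ HeavyTopWordLaw := by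
  constructor
  · rintro ⟨C₀, n₀, h⟩
    exact ⟨C₀, n₀, fun n hn m' hm N hN hnil hK => (flagCheap_iff_wordCheap N hN).1 (h n hn m' hm N hN hnil hK)⟩
  · rintro ⟨C₀, n₀, h⟩
    exact ⟨C₀, n₀, fun n hn m' hm N hN hnil hK => (flagCheap_iff_wordCheap N hN).2 (h n hn m' hm N hN hnil hK)⟩

/-! ## Word toolkit: zero and square-zero letters, powers, index versus budget (val-idea-9 g4, §8) -/

/-- Prepending a letter multiplies the word on the left. -/
theorem word_cons (T₀ T₁ : Matrix (Fin m) (Fin m) ℂ) (b : Bool) (w : List Bool) :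
    word T₀ T₁ (b :: w) = (if b then T₁ else T₀) * word T₀ T₁ w := by
  simp [word]

/-- A word containing the zero letter vanishes. -/
theorem word_zero_right_eq_zero (T₀ : Matrix (Fin m) (Fin m) ℂ) (w : List Bool) (h : true ∈ w) : word T₀ 0 w = 0 := by
  unfold word
  apply List.prod_eq_zero
  rw [List.mem_map]
  exact ⟨true, h, by simp⟩

/-- A pair with zero top is word-tame with budget `0` (profile `(r, c, Θ) = (0, 1, 0)`). -/
theorem wordTame_zero_right (n : ℕ) (T₀ : Matrix (Fin m) (Fin m) ℂ) : WordTame n 0 T₀ 0 := by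
  refine ⟨0, 1, 0, le_rfl, by simp, fun w hw => ?_⟩
  have : w.count true = 0 := by
    rw [List.count_eq_zero]
    intro h
    exact hw (word_zero_right_eq_zero T₀ w h)
  simp [this]

/-- Words in a square-zero letter: a nonzero word has no two adjacent `Q`s, hence `#Q ≤ #P + 1`. -/
theorem count_true_le_of_sq_eq_zero (P Q : Matrix (Fin m) (Fin m) ℂ) (hQ : Q * Q = 0) :
    ∀ w : List Bool, word P Q w ≠ 0 → w.count true ≤ w.count false + 1
  | [], _ => by simp
  | [true], _ => by simp
  | [false], _ => by simp
  | true :: true :: w, h => by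
      exfalso; apply h
      rw [word_cons, word_cons, ← Matrix.mul_assoc]
      simp [hQ]
  | true :: false :: w, h => by
      have h' : word P Q w ≠ 0 := by
        intro hw; apply h; rw [word_cons, word_cons, hw]; simp
      have := count_true_le_of_sq_eq_zero P Q hQ w h'
      simp at this ⊢
      omega
  | false :: b :: w, h => by
      have h' : word P Q (b :: w) ≠ 0 := by
        intro hw; apply h; rw [word_cons, hw]; simp
      have := count_true_le_of_sq_eq_zero P Q hQ (b :: w) h'
      simp [List.count_cons] at this ⊢
      omega

/-- **Square-zero tops are tame with budget `⌊n/2⌋`** (profile `(r, c, Θ) = (1, 1, 1)`); at `n = 3` this is budget `1`. -/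
theorem wordTame_of_sq_eq_zero {n k : ℕ} (hk : n / 2 ≤ k) (P Q : Matrix (Fin m) (Fin m) ℂ) (hQ : Q * Q = 0) :
    WordTame n k P Q := by
  refine ⟨1, 1, 1, le_rfl, by omega, fun w hw => ?_⟩
  have := count_true_le_of_sq_eq_zero P Q hQ w hw
  omega

/-- The constant word `Q⋯Q` is the power `Q^j`. -/
theorem word_replicate_true (P Q : Matrix (Fin m) (Fin m) ℂ) (j : ℕ) : word P Q (List.replicate j true) = Q ^ j := by
  simp [word, List.map_replicate, List.prod_replicate]

/-- **Budget `k` forces index `≤ k + 1`** when `k + 2 ≤ n` (word form of ✓ p613488 `linPart_pow_eq_zero_of_flagCheap`): the word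
`Q^{k+1}` costs `c(k+1) ≤ Θ`, incompatible with `⌊(Θ + r(n−1))/(c+r)⌋ ≤ k`. -/
theorem pow_eq_zero_of_wordTame {n k : ℕ} (hkn : k + 2 ≤ n) (P Q : Matrix (Fin m) (Fin m) ℂ) (h : WordTame n k P Q) :
    Q ^ (k + 1) = 0 := by
  obtain ⟨r, c, Θ, hc, hbud, hw⟩ := h
  by_contra hne
  have hword := hw (List.replicate (k + 1) true) (by rw [word_replicate_true]; exact hne)
  simp only [List.count_replicate_self, List.count_replicate] at hword
  have hlt : Θ + r * (n - 1) < (k + 1) * (c + r) :=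
    (Nat.div_lt_iff_lt_mul (by omega)).1 (Nat.lt_succ_of_le hbud)
  obtain ⟨n1, hn1⟩ : ∃ n1, n - 1 = n1 := ⟨_, rfl⟩
  have hkn1 : k + 1 ≤ n1 := by omega
  rw [hn1] at hlt
  have hmono : r * (k + 1) ≤ r * n1 := Nat.mul_le_mul_left r hkn1
  simp at hword
  nlinarith [hword, hlt, hmono]

end Summit.ValiantsHypothesis.ValiantsHypothesis.Theorems.GrenetZeon.RadicalSplit

end
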